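import Summits.QuantumAdvantage.QuantumAdvantage.Theorems.HintDialAnfLadder

/-!
# HintDialCovariance — module 10/10 of the HintDial THEOREMS package (cell decomp-qadv, lens-3 generation 6)

§10: AFFINE COVARIANCE OF DUALITY — `isDualOf_affine` (the dual of `x ↦ F(Ax ⊕ s) ⊕ ⟨t,x⟩ ⊕ c` is `y ↦ G(B(y ⊕ t)) ⊕ ⟨B(y ⊕ t), s⟩ ⊕ c`, `B` an
inverse-transpose of the cube permutation `A`), `dualBit_affine` (the dual bit at the origin of ANY dual is `G(Bt) ⊕ ⟨Bt, s⟩ ⊕ c` — the HIDDEN-SHIFT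
formula typing the W-leaf on a mixed orbit), `invTranspose_bxor` (an inverse-transpose is additive), `Automaton.bd_comm/bd_bxor_left/bd_ext`.

Provenance: split of the farm-checked single file `HintDialTheorems.lean` (HOME/decomp-qadv-lens-3/g6/tree/; rc 0 · no proof holes ·
axioms ⊆ {propext, Classical.choice, Quot.sound}); mathematical record: HOME/decomp-qadv-lens-3/g6/NODE-g6.md.  Modules in order:
HintDialDuality → HintDialLevels → HintDialAutomaton → HintDialLeakLaw → HintDialPlanting → HintDialClosure → HintDialTable → HintDialLowDegree → HintDialAnfLadder → HintDialCovariance (each imports its predecessor).  Namespace `Summit.QuantumAdvantage.QuantumAdvantage.Theorems.HintDial`.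
-/

set_option linter.dupNamespace false

noncomputable section

namespace Summit.QuantumAdvantage.QuantumAdvantage.Theorems.HintDial

open Summit.QuantumAdvantage.QuantumAdvantage.Theses.AnfPresentation
  (RungA LiftA NearExactIsExact SignedExactSliceIsLift AnfEquiv RungANonuniform)

open Finset
open Literature.Computability.Complexity
open Literature.Computability.QuantumComplexity
open Literature.Computability.MetaComplexity
open _root_.Computability (encodeNat)
/-! ## §10 ★★ AFFINE COVARIANCE OF DUALITY — the HIDDEN-SHIFT FORMULA (v1.5).  If `G` is the dual of `F` and `A` is a permutation
of the cube with an «inverse-transpose» `B` (`⟨y, A⁻¹u⟩ = ⟨By, u⟩` for all `y, u`; this forces `A` linear and `B = A^{-T}`), then the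
dual of the hidden-affine-mixed function `x ↦ F(Ax ⊕ s) ⊕ ⟨t,x⟩ ⊕ c` is `y ↦ G(B(y ⊕ t)) ⊕ ⟨B(y ⊕ t), s⟩ ⊕ c`, and the DUAL BIT AT
THE ORIGIN of ANY dual is `G(Bt) ⊕ ⟨Bt, s⟩ ⊕ c` — the exponent of the bent pairing at the DUAL SHIFT `u = Bt`.  This types the
W-leaf on a hidden-mixed orbit (record NODE-g6.md §v1.3b): level 2 reveals cubic images of `(A, s)` and of `(B, u)` and asks for
`G(u) ⊕ ⟨u, s⟩ ⊕ c`; for separated (un-mixed) Maiorana–McFarland data this is the LEAK LAW of §4. -/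

section Covariance

open BuzetChailloux (bxor bxorPerm zeroVec)
open Automaton (bd sgl)
open DerivativeWalsh (W)

variable {n : ℕ}

/-- HintDial helper `Automaton.bd_comm` (lens-3 g6 HintDial THEOREMS package; see the enclosing section docstring). -/
theorem Automaton.bd_comm (u v : Fin n → Bool) : bd u v = bd v u :=
  bit_injective (by rw [Automaton.bit_bd, Automaton.bit_bd]; exact Finset.sum_congr rfl fun i _ => mul_comm _ _)

/-- HintDial helper `Automaton.bd_bxor_left` (lens-3 g6 HintDial THEOREMS package; see the enclosing section docstring). -/
theorem Automaton.bd_bxor_left (p q x : Fin n → Bool) : bd (bxor p q) x = xor (bd p x) (bd q x) := by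
  rw [Automaton.bd_comm, Automaton.bd_bxor_right, Automaton.bd_comm x p, Automaton.bd_comm x q]

/-- `⟨·,·⟩` is non-degenerate. -/
theorem Automaton.bd_ext {a b : Fin n → Bool} (h : ∀ u, bd a u = bd b u) : a = b :=
  funext fun i => by rw [← Automaton.bd_sgl_right a i, h, Automaton.bd_sgl_right]

/-- An inverse-transpose `B` of a cube permutation `A` is automatically ADDITIVE. -/
theorem invTranspose_bxor (A : Equiv.Perm (Fin n → Bool)) (B : (Fin n → Bool) → (Fin n → Bool))
    (hB : ∀ y u, bd y (A.symm u) = bd (B y) u) (y t : Fin n → Bool) : B (bxor y t) = bxor (B y) (B t) :=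
  Automaton.bd_ext fun u => by rw [← hB, Automaton.bd_bxor_left, hB, hB, Automaton.bd_bxor_left]

/-- ★★ AFFINE COVARIANCE OF DUALITY: the dual of `x ↦ F(Ax ⊕ s) ⊕ ⟨t,x⟩ ⊕ c` is `y ↦ G(B(y ⊕ t)) ⊕ ⟨B(y ⊕ t), s⟩ ⊕ c`. -/
theorem isDualOf_affine {F G : (Fin n → Bool) → Bool} (hFG : IsDualOf F G)
    (A : Equiv.Perm (Fin n → Bool)) (B : (Fin n → Bool) → (Fin n → Bool))
    (hB : ∀ y u, bd y (A.symm u) = bd (B y) u) (s t : Fin n → Bool) (c : Bool) :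
    IsDualOf (fun x => xor (xor (F (bxor (A x) s)) (bd t x)) c)
      (fun y => xor (xor (G (B (bxor y t))) (bd (B (bxor y t)) s)) c) := by
  intro y
  -- the summand, re-expressed through `u = s ⊕ Ax`
  have hsum : ∀ x : Fin n → Bool, signOf (xor (xor (F (bxor (A x) s)) (bd t x)) c) * twist x y
      = (signOf c * twist (B t) s * twist (B y) s) * (signOf (F (bxor s (A x))) * twist (bxor s (A x)) (bxor (B y) (B t))) := by
    intro x
    have h1 : twist t x = twist (B t) s * twist (B t) (bxor s (A x)) := by
      rw [← Automaton.signOf_bd t x, ← Automaton.signOf_bd (B t) s, ← Automaton.signOf_bd (B t) (bxor s (A x)), ← signOf_xor,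
        ← Automaton.bd_bxor_right, BuzetChailloux.bxor_bxor_cancel_left]
      congr 1
      simpa using hB t (A x)
    have h2 : twist x y = twist (B y) s * twist (B y) (bxor s (A x)) := by
      rw [twist_comm x y, ← Automaton.signOf_bd y x, ← Automaton.signOf_bd (B y) s, ← Automaton.signOf_bd (B y) (bxor s (A x)),
        ← signOf_xor, ← Automaton.bd_bxor_right, BuzetChailloux.bxor_bxor_cancel_left]
      congr 1
      simpa using hB y (A x)
    rw [signOf_xor, signOf_xor, Automaton.signOf_bd, h1, h2, BuzetChailloux.bxor_comm (A x) s,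
      Literature.Computability.QuantumComplexity.BuzetChailloux.twist_bxor_right (bxor s (A x)) (B y) (B t), twist_comm (B t) (bxor s (A x)), twist_comm (B y) (bxor s (A x))]
    ring
  have hW : ∑ u : Fin n → Bool, signOf (F u) * twist u (bxor (B y) (B t)) = Real.sqrt (2 ^ n) * signOf (G (bxor (B y) (B t))) := by
    have := hFG (bxor (B y) (B t)); rwa [DerivativeWalsh.W] at this
  show W _ y = _
  rw [DerivativeWalsh.W]
  simp_rw [hsum]
  rw [← Finset.mul_sum,
    Fintype.sum_equiv (A.trans (bxorPerm s)) (fun x => signOf (F (bxor s (A x))) * twist (bxor s (A x)) (bxor (B y) (B t)))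
      (fun u => signOf (F u) * twist u (bxor (B y) (B t))) (fun x => by simp only [Equiv.trans_apply, BuzetChailloux.bxorPerm_apply]),
    hW, invTranspose_bxor A B hB y t, signOf_xor, signOf_xor, Automaton.signOf_bd, DerivativeWalsh.twist_bxor_left]
  ring

/-- ★★ THE DUAL BIT AT THE ORIGIN on a hidden-mixed orbit: for ANY dual `G'` of `x ↦ F(Ax ⊕ s) ⊕ ⟨t,x⟩ ⊕ c`,
`G'(0) = G(Bt) ⊕ ⟨Bt, s⟩ ⊕ c` — the exponent of the bent pairing at the DUAL SHIFT `u = Bt`. -/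
theorem dualBit_affine {F G G' : (Fin n → Bool) → Bool} (hFG : IsDualOf F G)
    (A : Equiv.Perm (Fin n → Bool)) (B : (Fin n → Bool) → (Fin n → Bool))
    (hB : ∀ y u, bd y (A.symm u) = bd (B y) u) (s t : Fin n → Bool) (c : Bool)
    (hG' : IsDualOf (fun x => xor (xor (F (bxor (A x) s)) (bd t x)) c) G') :
    G' zeroVec = xor (xor (G (B t)) (bd (B t) s)) c := by
  rw [← Automaton.isDualOf_unique (isDualOf_affine hFG A B hB s t c) hG']
  simp only [BuzetChailloux.zeroVec_bxor]

/-- Duality is an involution on bent Boolean functions (char 2: `F̃̃ = F`). -/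
theorem isDualOf_symm {F G : (Fin n → Bool) → Bool} (h : IsDualOf F G) : IsDualOf G F :=
  isDualOf_of_forrelation_eq_one (by rw [Literature.Computability.QuantumComplexity.MMReadout.forrelation_symm']; exact forrelation_eq_one_of_isDualOf h)

/-- ★★ LEVEL 2 IS LEVEL 1 WITH A HIDDEN TRANSLATION.  If `G₀` is the dual of `F`, the general level-2 hint is `G = G₀ ⊕ ⟨s,·⟩ ⊕ β`
(unknown `s`, `β`), and ITS dual is `x ↦ F(x ⊕ s) ⊕ β`: reading the instance `(F, G)` backwards, `G` is a bent cubic presented EXACTLY and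
`F` is its dual TRANSLATED by the hidden `s` (and off by the constant `β`); level 1 is the sub-case `s = 0`.  So `Lift21 : HintRung 2 → HintRung 1`
asks precisely whether hiding a translation of the exactly-presented partner can create `P`-uniform `AC⁰[2]` hardness that is absent without it. -/
theorem isDualOf_hint_two {F G₀ : (Fin n → Bool) → Bool} (h : IsDualOf F G₀) (s : Fin n → Bool) (β : Bool) :
    IsDualOf (fun y => xor (xor (G₀ y) (bd s y)) β) (fun x => xor (F (bxor x s)) β) := by
  have e := isDualOf_affine (isDualOf_symm h) (Equiv.refl _) id (fun _ _ => rfl) zeroVec s β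
  simpa [Automaton.bd_zeroVec_right] using e

/-- ★ THE LEVEL-2 ANSWER BIT through the hint's own dual: with `G = G₀ ⊕ ⟨s,·⟩ ⊕ β` as above and `G'` ANY dual of `G`,
the sought bit `G₀(0) = F̃(0)` equals `G(0) ⊕ F(0) ⊕ G'(s)` — two visible bits and ONE value of the hint's dual AT THE HIDDEN SHIFT. -/
theorem hint_two_answer {F G₀ G' : (Fin n → Bool) → Bool} (h : IsDualOf F G₀) (s : Fin n → Bool) (β : Bool)
    (hG' : IsDualOf (fun y => xor (xor (G₀ y) (bd s y)) β) G') :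
    G₀ zeroVec = xor (xor (xor (xor (G₀ zeroVec) (bd s zeroVec)) β) (F zeroVec)) (G' s) := by
  rw [← Automaton.isDualOf_unique (isDualOf_hint_two h s β) hG']
  simp only [Automaton.bd_zeroVec_right, BuzetChailloux.bxor_self, Bool.xor_false]
  cases G₀ zeroVec <;> cases F zeroVec <;> cases β <;> rfl

end Covariance

end Summit.QuantumAdvantage.QuantumAdvantage.Theorems.HintDial

end
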